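import Literature.Claims.NS.ClayPeriodScalingBridge
import Literature.Claims.NS.ClayPeriodicPressureBridge
import Literature.Claims.NS.ClayPeriodicBlowupAlternative
import Literature.Analysis.FluidPDE.NSLerayHopf
import HarnessLib

/-!
# C139 `Gnayoro2026` — J. F. R. Gnayoro, «Finite-time blow-up for the 3D Navier–Stokes equations:
# alignment, Riccati and energy closure» (Zenodo 22117097, version created 2026-08-26, 9 pp.)

Claim skeleton of the D-0090 «where NS proofs break» map (cell `ns-claims`), typist of record
ns-claims-typist-12 g5. Text of record: the census pin `census/texts/Gnayoro2026/` (PDF sha16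
ac22e07702876186; PDF page = printed page; line numbers below are those of the pdfium text layer
`pages/pNNN.txt`). Direction NEG (blow-up) on `𝕋³ = [0,2π]³`, unforced, `ν = 1`, ONE explicit datum —
Clay (D)-type.

## The printed statements (verbatim)

* **Theorem 1.1** (p.2 l.2–11): «Let ν = 1. There exists an initial data u₀ ∈ C∞σ(𝕋³) defined
  explicitly in (2.3) with parameter A = 10⁵, such that the maximal classical solution
  u ∈ C([0,T), H³σ) of (1.1) blows up in finite time T in the sense: T_* ≤ 64π / A = 2.010619 × 10⁻³.
  Moreover, for all t ∈ [0, T_*) we have the lower bounds: ‖u(t)‖L∞(𝕋³) ≥ 1/[64π (T_* − t)],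
  ‖ω(t)‖L∞(𝕋³) ≥ 1/[64π (T_* − t)]. And the following asymptotic profile as t → T_*⁻:
  R(t) := ‖u(t)‖L∞ = 1/c₀(T_*−t), ℓ(t) ∼ √[ν(T_*−t)] (1.3) with c₀ = 1/(64π).»
* **§2.1** (p.2 l.13–21): «R(t) := ‖u(t)‖L∞ = supₓ∈𝕋³ |u(t,x)|», «Ωₜ := { x ∈ 𝕋³ : |u(t,x)| ≥ R(t)/2 }»,
  «û := u/|u|, ω̂ := ω/|ω| defined on Ωₜ», «c₀ := 1/(64π)».
* **§2.3** (p.2 l.25–27): «Let ρ = 0.01, x₀ = (π,0,0), e_z = (0,0,1). Let χ ∈ C_c∞(ℝ³) be radial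
  such that 0 ≤ χ ≤ 1, χ ≡ 1 on B(0,ρ/2), supp χ ⊂ B(0,ρ), and ∫ℝ³ χ = 1.»
* **Definition 2.1** (p.3 l.2–5): «u₀(x) = A ⋅ χ(x−x₀) ⋅ e_z ⋅ exp(−|x−x₀|²/ρ²) + u_bg(x) (2.3) where
  u_bg ∈ C∞_σ satisfies ‖u_bg‖H³ ≤ 1 and ensures that u₀ has reflection symmetries with respect to
  the planes x₁=π, x₂=0, x₃=0.»
* **Proposition 2.2** (p.3 l.6–12): «For (2.3) with A=10⁵: 1. u₀ ∈ C∞_σ(𝕋³) and ∇ ⋅ u₀ = 0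
  2. R(0) = ‖u₀‖L∞ = A = 10⁵, attained at x₀. 3. ‖ω₀‖L∞ = A(1+O(ρ)) 4. Φ(0) := infₓ∈Ω₀ û₀(x) ⋅ ω̂₀(x) = 1
  5. E(0) := ‖u₀‖L² ≤ C A² ρ³ ≤ 10⁴».
* **Theorem 2.3** (p.3 l.13–14): «For u₀ ∈ H³_σ, there exists T₀ = T₀(‖u₀‖H³) > 0 and a unique
  solution u ∈ C([0,T₀], H³_σ) of (1.1).»
* **Definition 3.1 / Theorem 3.3** (p.3 l.16–23): «Φ(t) := infₓ∈Ωₜ û(t,x) ⋅ ω̂(t,x) ∈ [−1,1] (3.1)»;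
  «If Φ(0) = 1 then for all t ∈ [0,T_*): Φ(t) ≥ 1 − 2 × 10⁻⁴» (made «unconditional» by Cor 6.4 p.7 l.13–16).
* **Lemma 4.1** (p.4 l.24–26): «Under the hypothesis of Thm 3.3, let xₜ such that |u(t,xₜ)| = R(t).
  Then: Ωₜ ⊂ B(xₜ, rₜ) with rₜ := 1/(2 R(t)) and |Ωₜ| ≥ c₁ R(t)⁻³ (4.1)».
* **Proposition 5.4** (p.6 l.5–6): «dR/dt ≥ c₀ R(t)² − 8 ν ‖∇ω(t)‖₂² / R(t)² (5.4)».
* **Lemma 6.2** (p.6 l.18–20): «Under Thm 3.3: ‖∇ω(t)‖₂² ≤ C R(t)³ (6.2)».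
* **Corollary 6.3** (p.7 l.10–12): «Inserting (6.2) into (5.4): dR/dt ≥ c₀ R² − C R ≥ (c₀/2) R² for
  R ≥ R₀ (6.3)».
* **Proof of Theorem 1.1** (p.7 l.17–20): «For data (2.3): R(0)=10⁵, ‖∇ω(0)‖₂ ≤ C A/ρ = 10⁷. Thus
  R(0)⁴ ≫ 1024ν ‖∇ω(0)‖₂². By Cor 6.3, dR/dt ≥ (c₀/2) R². Integration gives T_* ≤ 2/(c₀ R(0)) = 64π/10⁵.
  The bound on ‖ω‖∞ comes from local Biot-Savart: ‖ω‖∞ ≥ c R on Ωₜ. ∎»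

## How it is typed

Vocabulary: `2πℤ³`-periodic smooth fields on `ℝ³ = EuclideanSpace ℝ (Fin 3)` (`IsPer`, period
`per = 2π`, the paper's `𝕋³ = [0,2π]³`), classical solutions `IsClassicalNSSolutionOn (Ico 0 T) ν 0 u p`
of the tree with `u(·,t)` AND `p(·,t)` periodic (`IsSol` — a solution on `𝕋³`), sup norms over `ℝ³`
(`supNorm`, = the sup over one cell for a periodic field), `L²` norms over the cell `[0,2π]³` (`cell`,
`h3NormSq`, `gradVortSq`), the tree's `curl`. The blow-up clause «the maximal classical solution blows
up at a time T_* ≤ T₁» is `BlowsUpBy ν u₀ T₁`: every `𝕋³`-classical solution on `[0,T)` issued from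
`u₀` has `T ≤ T₁` (no maximal-solution object is needed; smooth in place of `C([0,T),H³σ)` is the
Δ5-free classical reading). The CLAIMED THEOREM `ClaimedTheorem` is the Clay-grain content of Thm 1.1
(∃ smooth divergence-free periodic datum with `BlowsUpBy 1 u₀ (64π/A)`); `ClaimedTheoremExplicit` is
its verbatim «defined explicitly in (2.3)» face over the printed data class; both give PRINTED (D)
(`clayD_of_claimed`, `clayD_of_explicit`, through `ClayPeriodScalingBridge` with `L = 2π` and the Δ5
pressure bridge). The lower bounds and the profile (1.3) / Prop 7.1 involve the maximal time `T_*`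
itself and are recorded, not typed (not on the path to (D)).

The datum. `IsCutoff χ` is §2.3 VERBATIM (smooth, radial, `0 ≤ χ ≤ 1`, `χ = 1` on `‖x‖ < ρ/2`,
`χ = 0` on `ρ ≤ ‖x‖`, `∫ χ = 1`); `IsCutoff₀ χ` keeps the four size/support clauses that pp. 3–7 use
(the normalisation `∫ χ = 1` and radiality are used nowhere after p.2; with `ρ = 1/100`,
`∫ χ ≤ vol B(0,ρ) = 4π·10⁻⁶/3`, so the verbatim class is a kernel question of its own: `Step0_cutoff`).
`jet χ` is the explicit term of (2.3) on `ℝ³` (one copy, supported in `B(x₀,ρ)`), `IsBackground`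
the printed class of `u_bg` (smooth, divergence-free — the «σ» —, `2π`-periodic, `‖u_bg‖²_{H³(cell)} ≤ 1`;
the clause «ensures that u₀ has reflection symmetries w.r.t. the planes x₁=π, x₂=0, x₃=0» has no
printed definition for a vector field and is used nowhere on pp. 3–8: NOT typed, Δ recorded), and
`datum χ u_bg = jet χ ∘ wrap + u_bg` is (2.3) as a field on `𝕋³`, i.e. the `2π`-periodisation of the
jet (`wrap` reduces each coordinate into the period cell centred at `x₀`; `datum_eq_formula_nhds`:
near `x₀` it is literally `jet χ + u_bg`; `isPer_datum`). `isBackground_zero` and `exists_cutoff₀`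
exhibit members of the two classes the proof uses.

## Step table (dependency order as printed)

| Step | decl | print | typed content | typist's note |
|---|---|---|---|---|
| 0 | `Step0_cutoff` | §2.3 p.2 l.26–27 | `∃ χ, IsCutoff χ` | kernel-decidable (volume of `B(0,ρ)` vs `∫χ = 1`); `not_explicit_of_not_step0`; the normalisation is used nowhere after p.2 (erratum-class in the typist's reading — the referee decides) |
| 1 | `Step1_data` | Prop 2.2 (1) p.3 l.8 | `datum χ u_bg` smooth and divergence-free, ∀ admissible `χ, u_bg` (class `IsCutoff₀`) | census-predicted locator; `Step1_lit` = same over the verbatim class, `step1_lit_of_not_step0` |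
| 2 | `Step2_max` | Prop 2.2 (2) p.3 l.9 | `‖datum‖ ≤ A` everywhere, `= A` at `x₀` | — |
| — | (recorded) | Prop 2.2 (3), (5) p.3 l.10, l.12 | `‖ω₀‖∞ = A(1+O(ρ))` (O-term at fixed ρ), `E(0) ≤ 10⁴` | not typed (not decidable as printed / not used) |
| 4 | `Step4_align` | Prop 2.2 (4) p.3 l.11 | `Φ(0) = 1`: `IsAligned (datum χ u_bg)` (pointwise `û·ω̂ = 1` on `Ω₀` where `ω₀ ≠ 0`) | census-predicted locator |
| 5 | `Step5_local` | Thm 2.3 p.3 l.13–14 | periodic smooth local existence | classical, TRUE — `step5_local_holds` (Rev 4) |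
| 6 | `Step6_T33` | Thm 3.3 p.3 l.22–23 | `Φ(0)=1 ⇒ Φ(t) ≥ 1 − 2·10⁻⁴` | — |
| 7 | `Step7_L41` | Lemma 4.1 p.4 l.24–26 | `Ωₜ ⊆ B̄(xₜ, 1/(2R))`, `|Ωₜ ∩ cell| ≥ c₁R⁻³` | — |
| 8 | `Step8_P54` | Prop 5.4 p.6 l.5–6 | `c₀R² − 8ν‖∇ω‖₂²/R² ≤ dR/dt` | `deriv` of `t ↦ R(t)` |
| 9 | `Step9_L62` | Lemma 6.2 p.6 l.18–20 | `‖∇ω(t)‖₂² ≤ C R(t)³` | — |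
| 10 | `Step10_C63` | Cor 6.3 p.7 l.12 | `∃ R₀, … R ≥ R₀ ⇒ (c₀/2)R² ≤ dR/dt` | — |
| R | `StepR_cont` | §2.1 (1) p.2 l.15 (implicit) | `t ↦ R(t)` continuous on `[0,T)` | folklore, TRUE — `stepR_cont_holds` (Rev 3) |
| 11 | `Step11_integration` | p.7 l.19 «Integration gives T_* ≤ 2/(c₀R(0))» | ODE comparison, pure real analysis | TRUE — `step11_integration_holds` (Rev 2) |
| 12 | `Step12_proof` | p.7 l.18–19 «By Cor 6.3, dR/dt ≥ (c₀/2)R²» along the solution from (2.3) | — | the passage from Cor 6.3's «R ≥ R₀» (R₀ = 2C/c₀, C of Lemma 6.2 unprinted) to the datum's solution goes through «R(0)⁴ ≫ 1024ν‖∇ω(0)‖₂²», a different condition; no kernel implication `Step10 → Step12` is claimed |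

Composition: `delivered_of_steps : Step1_data → Step2_max → StepR_cont → Step12_proof →
Step11_integration → DeliveredTheorem`, where `DeliveredTheorem` carries the bound the printed proof
delivers, `Tproof = 2/(c₀A) = 128π/A` (p.7 l.19), which is TWICE Thm 1.1's `Tbound = 64π/A`
(`tproof_eq_two_mul_tbound`; the printed «2/(c₀R(0)) = 64π/10⁵» is an arithmetic slip: with
`c₀ = 1/(64π)`, `2/(c₀·10⁵) = 128π/10⁵`) — recorded; `BlowsUpBy.mono` and `claimed_of_explicit`,
`delivered_of_explicit` relate the faces. Steps 4, 6–10 are the printed support of Step 12 and are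
typed for the record and for the refuter; they are not consumed by the kernel composition (see the
note on Step 12).

## Kernel handles (typist's reading, no assertion; the refuter decides the grain)

(a) `Step0_cutoff`: `∫ χ ≤ volume.real (closedBall 0 ρ) = (4/3)πρ³ < 1` (Mathlib
`InnerProductSpace.volume_closedBall`/`EuclideanSpace.volume_ball`, `finrank = 3`). (b) `Step1_data`:
members `χ := ContDiffBump`-function at `0` with `rIn = ρ/2 < rOut < ρ` (cf. `exists_cutoff₀`),
`u_bg := 0` (`isBackground_zero`); near `x₀`, `datum = jet χ` (`datum_eq_formula_nhds`) and
`div (jet χ)(x₀ + (ρ/4)e_z) = A·∂_z(χG)(…) = −(A/(2ρ))e^{−1/16} ≠ 0` (`χ ≡ 1` there). (c) `Step4_align`: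
same members; at `x₀ ∈ Ω₀` (`‖datum x₀‖ = A = supNorm`), `curl (jet χ) x₀ = 0` (the gradient of the
radial profile vanishes at the centre), so the guarded statement is silent; at `x = x₀ + (ρ/4)e₁ ∈ Ω₀` (`χ = 1`, `|u| = Ae^{−1/16} ≥ A/2`):
`u(x) ∥ e_z` while `ω(x) = A∇(χG)(x − x₀) × e_z ≠ 0` is horizontal, so `alignment = 0 ≠ 1`. (d) Steps 6–10 quantify over all `𝕋³`-solutions with `Φ(0) = 1`: the tree's
viscous ABC flow `strongBeltramiVelocity ν 1 (abc a 0 0)` = `a e^{−νt}(sin x₃, cos x₃, 0)`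
(`Literature.Analysis.FluidPDE.BeltramiFlows`: `isClassicalNSSolutionOn_abc`, `curl_abc`, constant
speed `|u| ≡ a e^{−νt}`, so `Ωₜ = ℝ³`, `Φ ≡ 1`, `R(t) = a e^{−νt}`, `dR/dt = −νR < 0`,
`‖∇ω‖²_{L²(cell)} = 8π³a²e^{−2νt}`) bears on Step 7 (Ωₜ = ℝ³ ⊄ a ball), Step 8 and Step 10 (large
`a`), Step 9 (small `a`). (e) `Step12_proof` needs a solution from the datum itself (none explicit).

## References

* [Gnayoro2026] J. F. R. Gnayoro, *Finite-time blow-up for the 3D Navier–Stokes equations: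
  alignment, Riccati and energy closure*, Zenodo 22117097 (2026), doi:10.5281/zenodo.21280527.
* [FeffermanClay2006] C. L. Fefferman, *Existence and smoothness of the Navier–Stokes equation*, CMI
  2006, (D) with (8)–(11) p. 2.
* [Tao2013Localisation] T. Tao, Anal. PDE 6 (2013), Def. 1.1, Rem. 1.2, Lemma 4.1 (ii).
* [MajdaBertozziCUP2002] A. J. Majda, A. L. Bertozzi, CUP 2002, §2.3.2 (ABC flows).

WHAT THIS IS NOT: not a claim about NS regularity or blow-up; not a claim about any author beyond
the typed locator.
-/

noncomputable section

open Set MeasureTheory Metric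
open scoped ContDiff RealInnerProductSpace Topology

namespace Literature.Claims.NS.Gnayoro2026

open Literature.Analysis.FluidPDE Literature.Analysis.FunctionSpaces Literature.Claims.NS.ClayVariants

/-- `ℝ³`. [cite: Gnayoro2026, (1.1) p.1] -/
abbrev E3 : Type := EuclideanSpace ℝ (Fin 3)

/-! ## Parameters and the periodic vocabulary -/

/-- The period `2π` of the paper's torus `𝕋³ = [0,2π]³`. [cite: Gnayoro2026, abstract p.1 l.10] -/
def per : ℝ := 2 * Real.pi

/-- `2πℤ³`-periodicity of a field on `ℝ³` (a function on `𝕋³ = [0,2π]³`), in the shape used by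
`ClayPeriodScalingBridge`. [cite: Gnayoro2026, abstract p.1 l.10] -/
def IsPer {X : Type*} (v : E3 → X) : Prop :=
  ∀ (j : Fin 3) (x : E3), v (x + per • EuclideanSpace.single j 1) = v x

/-- `ρ = 0.01`. [cite: Gnayoro2026, §2.3 p.2 l.26] -/
def rho : ℝ := 1 / 100

/-- `A = 10⁵`. [cite: Gnayoro2026, Thm 1.1 p.2 l.3–4] -/
def amp : ℝ := 10 ^ 5

/-- `x₀ = (π, 0, 0)`. [cite: Gnayoro2026, §2.3 p.2 l.26] -/
def ctr : E3 := !₂[Real.pi, 0, 0]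

/-- `e_z = (0, 0, 1)`. [cite: Gnayoro2026, §2.3 p.2 l.26] -/
def ez : E3 := EuclideanSpace.single 2 1

/-- `c₀ = 1/(64π)`. [cite: Gnayoro2026, §2.1 (7) p.2 l.21] -/
def c0 : ℝ := 1 / (64 * Real.pi)

/-- Thm 1.1's blow-up time bound `64π/A`. [cite: Gnayoro2026, Thm 1.1 p.2 l.6] -/
def Tbound : ℝ := 64 * Real.pi / amp

/-- The bound the printed proof delivers, `2/(c₀R(0))` with `R(0) = A`. [cite: Gnayoro2026, Proof of Thm 1.1 p.7 l.19] -/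
def Tproof : ℝ := 2 / (c0 * amp)

/-- `2/(c₀A) = 128π/A = 2 · (64π/A)`: the proof's bound is twice the theorem's.
[cite: Gnayoro2026, Thm 1.1 p.2 l.6 and p.7 l.19] -/
theorem tproof_eq_two_mul_tbound : Tproof = 2 * Tbound := by
  unfold Tproof Tbound c0 amp
  have hπ : Real.pi ≠ 0 := Real.pi_ne_zero
  field_simp

/-- `0 < 64π/A`. [cite: Gnayoro2026, Thm 1.1 p.2 l.6] -/
theorem tbound_pos : 0 < Tbound := by
  unfold Tbound amp
  positivity

/-! ## §2.3 / Definition 2.1: the explicit datum -/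

/-- §2.3 VERBATIM: «χ ∈ C_c∞(ℝ³) radial such that 0 ≤ χ ≤ 1, χ ≡ 1 on B(0,ρ/2), supp χ ⊂ B(0,ρ), and
∫ℝ³ χ = 1» (the support clause read pointwise: `χ = 0` off the open ball).
[cite: Gnayoro2026, §2.3 p.2 l.26–27] -/
def IsCutoff (χ : E3 → ℝ) : Prop :=
  ContDiff ℝ ∞ χ ∧ (∀ x y : E3, ‖x‖ = ‖y‖ → χ x = χ y) ∧ (∀ x, 0 ≤ χ x ∧ χ x ≤ 1) ∧
    (∀ x : E3, ‖x‖ < rho / 2 → χ x = 1) ∧ (∀ x : E3, rho ≤ ‖x‖ → χ x = 0) ∧ ∫ x, χ x = 1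

/-- The four clauses of §2.3 that pp. 3–7 use (smooth, `0 ≤ χ ≤ 1`, `χ = 1` on `B(0,ρ/2)`, `χ = 0`
off `B(0,ρ)`); radiality and `∫χ = 1` dropped. [cite: Gnayoro2026, §2.3 p.2 l.26–27] -/
def IsCutoff₀ (χ : E3 → ℝ) : Prop :=
  ContDiff ℝ ∞ χ ∧ (∀ x, 0 ≤ χ x ∧ χ x ≤ 1) ∧ (∀ x : E3, ‖x‖ < rho / 2 → χ x = 1) ∧
    (∀ x : E3, rho ≤ ‖x‖ → χ x = 0)

/-- The verbatim class is inside the used class. [cite: Gnayoro2026, §2.3 p.2 l.26–27] -/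
theorem IsCutoff.isCutoff₀ {χ : E3 → ℝ} (h : IsCutoff χ) : IsCutoff₀ χ :=
  ⟨h.1, h.2.2.1, h.2.2.2.1, h.2.2.2.2.1⟩

/-- A member of the used class: a smooth bump `= 1` on `B̄(0, ρ/2)`, supported in `B(0, 3ρ/4)`.
[cite: Gnayoro2026, §2.3 p.2 l.26–27] -/
theorem exists_cutoff₀ : ∃ χ : E3 → ℝ, IsCutoff₀ χ := by
  have h1 : (0 : ℝ) < rho / 2 := by unfold rho; norm_num
  have h2 : rho / 2 < 3 * rho / 4 := by unfold rho; norm_num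
  let f : ContDiffBump (0 : E3) := ⟨rho / 2, 3 * rho / 4, h1, h2⟩
  refine ⟨f, f.contDiff, fun x => ⟨f.nonneg, f.le_one⟩, fun x hx => ?_, fun x hx => ?_⟩
  · exact f.one_of_mem_closedBall (by simpa using hx.le)
  · refine f.zero_of_le_dist ?_
    have : 3 * rho / 4 ≤ ‖x‖ := by unfold rho at hx ⊢; linarith
    simpa using this

/-- The Gaussian factor `exp(−|y|²/ρ²)` (in the variable `y = x − x₀`). [cite: Gnayoro2026, Def 2.1 (2.3) p.3 l.3] -/
def gauss (y : E3) : ℝ := Real.exp (-(‖y‖ ^ 2 / rho ^ 2))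

/-- The explicit term of (2.3) on `ℝ³`: `A χ(x − x₀) exp(−|x−x₀|²/ρ²) e_z` (one copy, supported in
`B(x₀, ρ)`). [cite: Gnayoro2026, Def 2.1 (2.3) p.3 l.3] -/
def jet (χ : E3 → ℝ) (x : E3) : E3 := (amp * χ (x - ctr) * gauss (x - ctr)) • ez

/-- The period cell `[0, 2π]³` of `𝕋³`. [cite: Gnayoro2026, abstract p.1 l.10] -/
def cell : Set E3 := {x | ∀ i, x i ∈ Icc (0 : ℝ) per}

/-- `‖v‖²_{H³(𝕋³)} = Σ_{n ≤ 3} ∫_{cell} |Dⁿv|²`. [cite: Gnayoro2026, Def 2.1 p.3 l.4] -/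
def h3NormSq (v : E3 → E3) : ℝ := ∑ n ∈ Finset.range 4, ∫ x in cell, ‖iteratedFDeriv ℝ n v x‖ ^ 2

/-- The printed class of the background: «u_bg ∈ C∞_σ satisfies ‖u_bg‖H³ ≤ 1» on `𝕋³` (smooth,
divergence-free, `2π`-periodic, `‖u_bg‖²_{H³} ≤ 1`); the reflection-symmetry clause is not typed (no
printed definition, unused on pp. 3–8). [cite: Gnayoro2026, Def 2.1 p.3 l.4–5] -/
def IsBackground (ub : E3 → E3) : Prop :=
  ContDiff ℝ ∞ ub ∧ NSWave0.IsDivFree ub ∧ IsPer ub ∧ h3NormSq ub ≤ 1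

/-- (2.3) read as a field on `ℝ³`: `jet χ + u_bg`. [cite: Gnayoro2026, Def 2.1 (2.3) p.3 l.3] -/
def formula (χ : E3 → ℝ) (ub : E3 → E3) (x : E3) : E3 := jet χ x + ub x

/-- Reduction of `x ∈ ℝ³` into the period cell `Π_i [x₀ᵢ − π, x₀ᵢ + π)` centred at `x₀`
(coordinatewise `toIcoMod`). [cite: Gnayoro2026, abstract p.1 l.10 with §2.3 p.2 l.26] -/
def wrap (x : E3) : E3 :=
  WithLp.toLp 2 fun i => toIcoMod Real.two_pi_pos (ctr i - Real.pi) (x i)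

/-- **The datum (2.3) on `𝕋³ = [0,2π]³`**: the `2π`-periodisation of the jet plus the background.
[cite: Gnayoro2026, Def 2.1 (2.3) p.3 l.3–5] -/
def datum (χ : E3 → ℝ) (ub : E3 → E3) (x : E3) : E3 := jet χ (wrap x) + ub x

/-- Coordinates of `wrap`. [cite: Gnayoro2026, Def 2.1 (2.3) p.3 l.3] -/
theorem wrap_apply (x : E3) (i : Fin 3) :
    wrap x i = toIcoMod Real.two_pi_pos (ctr i - Real.pi) (x i) := rfl

/-- `wrap` is the identity on the cell centred at `x₀`. [cite: Gnayoro2026, Def 2.1 (2.3) p.3 l.3] -/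
theorem wrap_eq_self {x : E3} (hx : ∀ i, x i ∈ Ico (ctr i - Real.pi) (ctr i + Real.pi)) :
    wrap x = x := by
  ext i
  rw [wrap_apply, toIcoMod_eq_self]
  have h := hx i
  have : ctr i - Real.pi + 2 * Real.pi = ctr i + Real.pi := by ring
  rw [this]
  exact h

/-- `wrap` is `2π`-periodic. [cite: Gnayoro2026, Def 2.1 (2.3) p.3 l.3] -/
theorem wrap_add_per (j : Fin 3) (x : E3) : wrap (x + per • EuclideanSpace.single j 1) = wrap x := by
  ext i
  rw [wrap_apply, wrap_apply]
  by_cases h : i = j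
  · subst h
    have : (x + per • EuclideanSpace.single i (1 : ℝ)) i = x i + 2 * Real.pi := by simp [per]
    rw [this, toIcoMod_add_right]
  · have : (x + per • EuclideanSpace.single j (1 : ℝ)) i = x i := by simp [h]
    rw [this]

/-- The datum is `2π`-periodic when the background is. [cite: Gnayoro2026, Prop 2.2 (1) p.3 l.8] -/
theorem isPer_datum {χ : E3 → ℝ} {ub : E3 → E3} (hub : IsPer ub) : IsPer (datum χ ub) := by
  intro j x
  simp only [datum, wrap_add_per, hub j x]

/-- On the cell centred at `x₀` the datum is literally (2.3). [cite: Gnayoro2026, Def 2.1 (2.3) p.3 l.3] -/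
theorem datum_eq_formula {χ : E3 → ℝ} {ub : E3 → E3} {x : E3}
    (hx : ∀ i, x i ∈ Ico (ctr i - Real.pi) (ctr i + Real.pi)) : datum χ ub x = formula χ ub x := by
  simp only [datum, formula, wrap_eq_self hx]

/-- Near `x₀` the datum is literally (2.3) (an open condition). [cite: Gnayoro2026, Def 2.1 (2.3) p.3 l.3] -/
theorem datum_eq_formula_nhds (χ : E3 → ℝ) (ub : E3 → E3) :
    datum χ ub =ᶠ[𝓝 ctr] formula χ ub := by
  have hopen : IsOpen {x : E3 | ∀ i, x i ∈ Ioo (ctr i - Real.pi) (ctr i + Real.pi)} := by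
    have : {x : E3 | ∀ i, x i ∈ Ioo (ctr i - Real.pi) (ctr i + Real.pi)} =
        ⋂ i, (fun x : E3 => x i) ⁻¹' Ioo (ctr i - Real.pi) (ctr i + Real.pi) := by
      ext x; simp
    rw [this]
    exact isOpen_iInter_of_finite fun i => (PiLp.continuous_apply 2 _ i).isOpen_preimage _ isOpen_Ioo
  have hmem : ctr ∈ {x : E3 | ∀ i, x i ∈ Ioo (ctr i - Real.pi) (ctr i + Real.pi)} := fun i =>
    ⟨by linarith [Real.pi_pos], by linarith [Real.pi_pos]⟩
  filter_upwards [hopen.mem_nhds hmem] with x hx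
  exact datum_eq_formula fun i => Ioo_subset_Ico_self (hx i)

/-- `u_bg = 0` is an admissible background. [cite: Gnayoro2026, Def 2.1 p.3 l.4] -/
theorem isBackground_zero : IsBackground 0 := by
  refine ⟨contDiff_const, fun x => ?_, fun j x => rfl, ?_⟩
  · simp [NSWave0.divergence]
  · have : h3NormSq 0 = 0 := by
      simp [h3NormSq]
    rw [this]
    norm_num

/-! ## §2.1: sup norm, maximum region, directions, alignment, enstrophy -/

/-- `R = ‖v‖_{L∞} = sup_x |v(x)|` (over `ℝ³`; for a periodic field, the sup over `𝕋³`).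
[cite: Gnayoro2026, §2.1 (1) p.2 l.15] -/
def supNorm (v : E3 → E3) : ℝ := ⨆ x, ‖v x‖

/-- `Ω = {x : |v(x)| ≥ R/2}`. [cite: Gnayoro2026, §2.1 (2) p.2 l.16] -/
def maxRegion (v : E3 → E3) : Set E3 := {x | supNorm v / 2 ≤ ‖v x‖}

/-- `ŵ = w/|w|` (`0 ↦ 0`). [cite: Gnayoro2026, §2.1 (3) p.2 l.17] -/
def dirn (w : E3) : E3 := ‖w‖⁻¹ • w

/-- `û(x) · ω̂(x)` with `ω = curl v`. [cite: Gnayoro2026, Def 3.1 (3.1) p.3 l.17] -/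
def alignment (v : E3 → E3) (x : E3) : ℝ := ⟪dirn (v x), dirn (curl v x)⟫

/-- «Φ := inf_{x ∈ Ω} û·ω̂ = 1», values in `[−1,1]`: typed pointwise, `û·ω̂ = 1` at every point of
`Ω` where the vorticity does not vanish («ω̂ := ω/|ω| defined on Ωₜ» presupposes `ω ≠ 0`; the guard
keeps the junk direction `dirn 0 = 0` out of the statement).
[cite: Gnayoro2026, Prop 2.2 (4) p.3 l.11 and Def 3.1 p.3 l.17 with §2.1 (3) p.2 l.17] -/
def IsAligned (v : E3 → E3) : Prop := ∀ x ∈ maxRegion v, curl v x ≠ 0 → alignment v x = 1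

/-- `|∇w(x)|²` (Frobenius). [cite: Gnayoro2026, abstract p.1 l.13 («‖∇ω‖₂²»)] -/
def gradSq (w : E3 → E3) (x : E3) : ℝ := ∑ j : Fin 3, ‖fderiv ℝ w x (EuclideanSpace.single j 1)‖ ^ 2

/-- `‖∇ω‖₂² = ∫_{𝕋³} |∇ curl v|²`. [cite: Gnayoro2026, Prop 5.4 (5.4) p.6 l.6] -/
def gradVortSq (v : E3 → E3) : ℝ := ∫ x in cell, gradSq (curl v) x

/-! ## Solutions on `𝕋³ × [0,T)` and the blow-up clause -/

/-- A classical solution of (1.1) on `𝕋³ × [0,T)`: the tree's classical solution on `ℝ³ × [0,T)`,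
unforced, with `2π`-periodic velocity and pressure slices. [cite: Gnayoro2026, (1.1) p.1 l.21–24] -/
def IsSol (ν T : ℝ) (u : ℝ → E3 → E3) (p : ℝ → E3 → ℝ) : Prop :=
  IsClassicalNSSolutionOn (Ico 0 T) ν 0 u p ∧ ∀ t ∈ Ico 0 T, IsPer (u t) ∧ IsPer (p t)

/-- `R(t) = ‖u(t)‖_{L∞}`. [cite: Gnayoro2026, §2.1 (1) p.2 l.15] -/
def R (u : ℝ → E3 → E3) (t : ℝ) : ℝ := supNorm (u t)

/-- «the maximal classical solution blows up in finite time T_* ≤ T₁»: every classical solution on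
`𝕋³ × [0,T)` issued from `u₀` has `T ≤ T₁`. [cite: Gnayoro2026, Thm 1.1 p.2 l.4–6] -/
def BlowsUpBy (ν : ℝ) (u₀ : E3 → E3) (T₁ : ℝ) : Prop :=
  ∀ (T : ℝ) (u : ℝ → E3 → E3) (p : ℝ → E3 → ℝ), IsSol ν T u p → u 0 = u₀ → T ≤ T₁

/-- Monotonicity of the blow-up clause in the bound. [cite: Gnayoro2026, Thm 1.1 p.2 l.6] -/
theorem BlowsUpBy.mono {ν : ℝ} {u₀ : E3 → E3} {T₁ T₂ : ℝ} (h : BlowsUpBy ν u₀ T₁) (h12 : T₁ ≤ T₂) :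
    BlowsUpBy ν u₀ T₂ :=
  fun T u p hs h0 => (h T u p hs h0).trans h12

/-! ## The claimed theorem and its faces -/

/-- **Theorem 1.1, Clay grain**: at `ν = 1` some smooth divergence-free `2π`-periodic datum has its
`𝕋³`-classical solutions confined to `[0, 64π/A)`, `A = 10⁵`. [cite: Gnayoro2026, Thm 1.1 p.2 l.2–6] -/
def ClaimedTheorem : Prop :=
  ∃ u₀ : E3 → E3, ContDiff ℝ ∞ u₀ ∧ NSWave0.IsDivFree u₀ ∧ IsPer u₀ ∧ BlowsUpBy 1 u₀ Tbound

/-- **Theorem 1.1, verbatim face** «defined explicitly in (2.3)»: the datum is `datum χ u_bg` for a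
cutoff of the §2.3 class and a background of the Def 2.1 class, and «u₀ ∈ C∞σ(𝕋³)».
[cite: Gnayoro2026, Thm 1.1 p.2 l.2–6 with Def 2.1 p.3 l.2–5] -/
def ClaimedTheoremExplicit : Prop :=
  ∃ (χ : E3 → ℝ) (ub : E3 → E3), IsCutoff χ ∧ IsBackground ub ∧ ContDiff ℝ ∞ (datum χ ub) ∧
    NSWave0.IsDivFree (datum χ ub) ∧ BlowsUpBy 1 (datum χ ub) Tbound

/-- **What the printed proof delivers** (p.7 l.19): the same over the USED cutoff class with the
bound `Tproof = 2/(c₀A)`. [cite: Gnayoro2026, Proof of Thm 1.1 p.7 l.17–19] -/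
def DeliveredTheorem : Prop :=
  ∃ (χ : E3 → ℝ) (ub : E3 → E3), IsCutoff₀ χ ∧ IsBackground ub ∧ ContDiff ℝ ∞ (datum χ ub) ∧
    NSWave0.IsDivFree (datum χ ub) ∧ BlowsUpBy 1 (datum χ ub) Tproof

/-- The verbatim face gives the Clay-grain face. [cite: Gnayoro2026, Thm 1.1 p.2 l.2–6] -/
theorem claimed_of_explicit (h : ClaimedTheoremExplicit) : ClaimedTheorem := by
  obtain ⟨χ, ub, _, hub, hs, hd, hb⟩ := h
  exact ⟨datum χ ub, hs, hd, isPer_datum hub.2.2.1, hb⟩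

/-- The verbatim face gives the delivered face (weaker bound, larger cutoff class).
[cite: Gnayoro2026, Thm 1.1 p.2 l.6 and p.7 l.19] -/
theorem delivered_of_explicit (h : ClaimedTheoremExplicit) : DeliveredTheorem := by
  obtain ⟨χ, ub, hχ, hub, hs, hd, hb⟩ := h
  refine ⟨χ, ub, hχ.isCutoff₀, hub, hs, hd, hb.mono ?_⟩
  rw [tproof_eq_two_mul_tbound]
  linarith [tbound_pos]

/-! ## Clay link: printed (D) -/

/-- **A `2π`-periodic datum whose `𝕋³`-classical solutions are confined to a bounded horizon proves
PRINTED (D)** (`NavierStokesBreakdownPeriodic`): a Fefferman-class global solution with periodic `u`, `p`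
would restrict to a classical solution on `[0, T₁+1)` (`isNavierStokesSolution_and_smooth_iff`);
period `2π ↦ 1` by Leray scaling in the errata class (`clayPeriodicErrata_solvable_nsRescaleData_iff`),
errata ↦ printed pressure convention (`clayPeriodic_solvable_zero_iff_errata`), one viscosity ↦ all
(`navierStokesBreakdownPeriodic_of_not_regularityAt`). [cite: FeffermanClay2006, (D) with (8) (10) (11) p.2]
[cite: Tao2013Localisation, Rem. 1.2 and Lemma 4.1 (ii)] -/
theorem clayD_of_blowsUpBy {ν : ℝ} (hν : 0 < ν) {u₀ : E3 → E3} (hs : ContDiff ℝ ∞ u₀)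
    (hd : NSWave0.IsDivFree u₀) (hper : IsPer u₀) {T₁ : ℝ} (hb : BlowsUpBy ν u₀ T₁) :
    Summit.NavierStokesRegularity.NavierStokesRegularity.NavierStokesBreakdownPeriodic := by
  have hL : (0 : ℝ) < per := by unfold per; positivity
  -- no Fefferman-class global solution with `2π`-periodic velocity and pressure slices
  have hno : ¬ ∃ (u : ℝ → E3 → E3) (p : ℝ → E3 → ℝ),
      IsSmoothOnHalfSpace u ∧ IsSmoothOnHalfSpace p ∧ IsNavierStokesSolution ν 0 u₀ u p ∧
        ∀ t, 0 ≤ t →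
          (∀ (j : Fin 3) (x : E3), u t (x + per • EuclideanSpace.single j 1) = u t x) ∧
            ∀ (j : Fin 3) (x : E3), p t (x + per • EuclideanSpace.single j 1) = p t x := by
    rintro ⟨u, p, hu, hp, hns, hper'⟩
    obtain ⟨hcl, h0⟩ := isNavierStokesSolution_and_smooth_iff.1 ⟨hns, hu, hp⟩
    have hsol : IsSol ν (T₁ + 1) u p :=
      ⟨hcl.mono Ico_subset_Ici_self (uniqueDiffOn_Ico 0 (T₁ + 1)), fun t ht => hper' t ht.1⟩
    have := hb (T₁ + 1) u p hsol h0
    linarith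
  have hnoE : ¬ clayPeriodicErrata.Solvable ν 0 (nsRescaleData per u₀) := fun h =>
    hno ((clayPeriodicErrata_solvable_nsRescaleData_iff hL ν u₀).mp h)
  have hnoP : ¬ clayPeriodic.Solvable ν 0 (nsRescaleData per u₀) := fun h =>
    hnoE ((clayPeriodic_solvable_zero_iff_errata ν _).mp h)
  refine navierStokesBreakdownPeriodic_of_not_regularityAt hν fun hreg => hnoP (hreg _ ?_ ?_ ?_)
  · have h : nsRescaleData per u₀ = fun x => per • u₀ (per • x) := funext fun x => rfl
    rw [h]
    exact (hs.comp (contDiff_const_smul per)).const_smul per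
  · have h : nsRescaleData per u₀ = fun x => per • (fun y => u₀ (per • y)) x := funext fun x => rfl
    rw [h]
    exact VectorCalculus.IsDivFree.const_smul
      ((hs.differentiable (by simp)).comp (differentiable_id.const_smul per))
      (VectorCalculus.IsDivFree.comp_smul hd per) per
  · exact isLatticePeriodic_nsRescaleData hper

/-- **Thm 1.1 ⇒ printed (D).** [cite: Gnayoro2026, Thm 1.1 p.2 l.2–6] [cite: FeffermanClay2006, (D) p.2] -/
theorem clayD_of_claimed (h : ClaimedTheorem) :
    Summit.NavierStokesRegularity.NavierStokesRegularity.NavierStokesBreakdownPeriodic := by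
  obtain ⟨u₀, hs, hd, hper, hb⟩ := h
  exact clayD_of_blowsUpBy one_pos hs hd hper hb

/-- **The verbatim face ⇒ printed (D).** [cite: Gnayoro2026, Thm 1.1 p.2 l.2–6] [cite: FeffermanClay2006, (D) p.2] -/
theorem clayD_of_explicit (h : ClaimedTheoremExplicit) :
    Summit.NavierStokesRegularity.NavierStokesRegularity.NavierStokesBreakdownPeriodic :=
  clayD_of_claimed (claimed_of_explicit h)

/-- **The delivered face ⇒ printed (D)** (any finite bound does). [cite: Gnayoro2026, p.7 l.19] [cite: FeffermanClay2006, (D) p.2] -/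
theorem clayD_of_delivered (h : DeliveredTheorem) :
    Summit.NavierStokesRegularity.NavierStokesRegularity.NavierStokesBreakdownPeriodic := by
  obtain ⟨χ, ub, _, hub, hs, hd, hb⟩ := h
  exact clayD_of_blowsUpBy one_pos hs hd (isPer_datum hub.2.2.1) hb

/-! ## The steps -/

/-- **Step 0 — §2.3 p.2 l.26–27**: a cutoff of the printed class exists («Let χ ∈ C_c∞(ℝ³) be radial
such that 0 ≤ χ ≤ 1, χ ≡ 1 on B(0,ρ/2), supp χ ⊂ B(0,ρ), and ∫ℝ³ χ = 1», `ρ = 0.01`).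
[cite: Gnayoro2026, §2.3 p.2 l.26–27] -/
def Step0_cutoff : Prop := ∃ χ : E3 → ℝ, IsCutoff χ

/-- **Step 1 — Proposition 2.2 (1) p.3 l.8** «u₀ ∈ C∞_σ(𝕋³) and ∇ ⋅ u₀ = 0», for (2.3) over the USED
cutoff class and the printed background class. [cite: Gnayoro2026, Prop 2.2 (1) p.3 l.8] -/
def Step1_data : Prop :=
  ∀ (χ : E3 → ℝ) (ub : E3 → E3), IsCutoff₀ χ → IsBackground ub →
    ContDiff ℝ ∞ (datum χ ub) ∧ NSWave0.IsDivFree (datum χ ub)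

/-- Step 1 over the VERBATIM cutoff class. [cite: Gnayoro2026, Prop 2.2 (1) p.3 l.8 with §2.3 p.2 l.26–27] -/
def Step1_lit : Prop :=
  ∀ (χ : E3 → ℝ) (ub : E3 → E3), IsCutoff χ → IsBackground ub →
    ContDiff ℝ ∞ (datum χ ub) ∧ NSWave0.IsDivFree (datum χ ub)

/-- The used-class face gives the verbatim face. [cite: Gnayoro2026, Prop 2.2 (1) p.3 l.8] -/
theorem step1_lit_of_step1 (h : Step1_data) : Step1_lit :=
  fun χ ub hχ hub => h χ ub hχ.isCutoff₀ hub

/-- If no verbatim cutoff exists, the verbatim face of Step 1 holds emptily.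
[cite: Gnayoro2026, §2.3 p.2 l.26–27] -/
theorem step1_lit_of_not_step0 (h : ¬ Step0_cutoff) : Step1_lit :=
  fun χ _ hχ _ => (h ⟨χ, hχ⟩).elim

/-- No verbatim cutoff ⇒ the verbatim face of Thm 1.1 («defined explicitly in (2.3)») has no witness.
[cite: Gnayoro2026, Thm 1.1 p.2 l.3 with §2.3 p.2 l.26–27] -/
theorem not_explicit_of_not_step0 (h : ¬ Step0_cutoff) : ¬ ClaimedTheoremExplicit :=
  fun ⟨χ, _, hχ, _⟩ => h ⟨χ, hχ⟩

/-- **Step 2 — Proposition 2.2 (2) p.3 l.9** «R(0) = ‖u₀‖L∞ = A = 10⁵, attained at x₀».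
[cite: Gnayoro2026, Prop 2.2 (2) p.3 l.9] -/
def Step2_max : Prop :=
  ∀ (χ : E3 → ℝ) (ub : E3 → E3), IsCutoff₀ χ → IsBackground ub →
    (∀ x, ‖datum χ ub x‖ ≤ amp) ∧ ‖datum χ ub ctr‖ = amp

/-- **Step 4 — Proposition 2.2 (4) p.3 l.11** «Φ(0) := infₓ∈Ω₀ û₀(x) ⋅ ω̂₀(x) = 1» (perfect
velocity–vorticity alignment on the maximum region of the datum). [cite: Gnayoro2026, Prop 2.2 (4) p.3 l.11] -/
def Step4_align : Prop :=
  ∀ (χ : E3 → ℝ) (ub : E3 → E3), IsCutoff₀ χ → IsBackground ub → IsAligned (datum χ ub)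

/-- **Step 5 — Theorem 2.3 p.3 l.13–14** (local existence, classical), in the periodic classical
vocabulary: every smooth divergence-free `2π`-periodic datum has a `𝕋³`-classical solution on some
`[0,T₀)`, `ν > 0`. [cite: Gnayoro2026, Thm 2.3 p.3 l.13–14] -/
def Step5_local : Prop :=
  ∀ ν : ℝ, 0 < ν → ∀ u₀ : E3 → E3, ContDiff ℝ ∞ u₀ → NSWave0.IsDivFree u₀ → IsPer u₀ →
    ∃ T : ℝ, 0 < T ∧ ∃ (u : ℝ → E3 → E3) (p : ℝ → E3 → ℝ), IsSol ν T u p ∧ u 0 = u₀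

/-- **Step 6 — Theorem 3.3 p.3 l.22–23** «If Φ(0) = 1 then for all t ∈ [0,T_*): Φ(t) ≥ 1 − 2 × 10⁻⁴»
(for every `𝕋³`-classical solution; «unconditional» by Cor 6.4 p.7 l.13–16).
[cite: Gnayoro2026, Thm 3.3 p.3 l.22–23] -/
def Step6_T33 : Prop :=
  ∀ ν : ℝ, 0 < ν → ∀ (T : ℝ) (u : ℝ → E3 → E3) (p : ℝ → E3 → ℝ), IsSol ν T u p → IsAligned (u 0) →
    ∀ t ∈ Ico 0 T, ∀ x ∈ maxRegion (u t), curl (u t) x ≠ 0 → 1 - 2 / 10 ^ 4 ≤ alignment (u t) x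

/-- **Step 7 — Lemma 4.1 p.4 l.24–26** «Under the hypothesis of Thm 3.3, let xₜ such that
|u(t,xₜ)| = R(t). Then: Ωₜ ⊂ B(xₜ, rₜ) with rₜ := 1/(2 R(t)) and |Ωₜ| ≥ c₁ R(t)⁻³» (closed ball;
`|Ωₜ|` = volume of `Ωₜ ∩ cell`; `c₁ > 0` universal). [cite: Gnayoro2026, Lemma 4.1 p.4 l.24–26] -/
def Step7_L41 : Prop :=
  ∃ c₁ : ℝ, 0 < c₁ ∧ ∀ ν : ℝ, 0 < ν → ∀ (T : ℝ) (u : ℝ → E3 → E3) (p : ℝ → E3 → ℝ), IsSol ν T u p →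
    IsAligned (u 0) → ∀ t ∈ Ico 0 T, ∀ xt : E3, ‖u t xt‖ = R u t →
      maxRegion (u t) ⊆ closedBall xt (1 / (2 * R u t)) ∧
        c₁ * (R u t)⁻¹ ^ 3 ≤ (volume (maxRegion (u t) ∩ cell)).toReal

/-- **Step 8 — Proposition 5.4 p.6 l.5–6** «dR/dt ≥ c₀ R(t)² − 8 ν ‖∇ω(t)‖₂² / R(t)²» (under Thm 3.3's
hypothesis, via Lemma 5.3 / Lemma 4.1; `dR/dt` = Mathlib `deriv` of `t ↦ R(t)`, which is `0` where `R`
is not differentiable — the print presupposes differentiability; the flows named in the module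
docstring have smooth `R`). [cite: Gnayoro2026, Prop 5.4 (5.4) p.6 l.5–6] -/
def Step8_P54 : Prop :=
  ∀ ν : ℝ, 0 < ν → ∀ (T : ℝ) (u : ℝ → E3 → E3) (p : ℝ → E3 → ℝ), IsSol ν T u p → IsAligned (u 0) →
    ∀ t ∈ Ioo 0 T, c0 * R u t ^ 2 - 8 * ν * gradVortSq (u t) / R u t ^ 2 ≤ deriv (R u) t

/-- **Step 9 — Lemma 6.2 p.6 l.18–20** «Under Thm 3.3: ‖∇ω(t)‖₂² ≤ C R(t)³» (`C` universal).
[cite: Gnayoro2026, Lemma 6.2 (6.2) p.6 l.18–20] -/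
def Step9_L62 : Prop :=
  ∃ C : ℝ, ∀ ν : ℝ, 0 < ν → ∀ (T : ℝ) (u : ℝ → E3 → E3) (p : ℝ → E3 → ℝ), IsSol ν T u p →
    IsAligned (u 0) → ∀ t ∈ Ico 0 T, gradVortSq (u t) ≤ C * R u t ^ 3

/-- **Step 10 — Corollary 6.3 p.7 l.10–12** «dR/dt ≥ c₀ R² − C R ≥ (c₀/2) R² for R ≥ R₀» (`R₀`
universal, unprinted). [cite: Gnayoro2026, Cor 6.3 (6.3) p.7 l.10–12] -/
def Step10_C63 : Prop :=
  ∃ R₀ : ℝ, ∀ ν : ℝ, 0 < ν → ∀ (T : ℝ) (u : ℝ → E3 → E3) (p : ℝ → E3 → ℝ), IsSol ν T u p →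
    IsAligned (u 0) → ∀ t ∈ Ioo 0 T, R₀ ≤ R u t → c0 / 2 * R u t ^ 2 ≤ deriv (R u) t

/-- **Step R — §2.1 (1) p.2 l.15, implicit**: `t ↦ R(t)` is continuous on `[0,T)` for a
`𝕋³`-classical solution (folklore; used by «Integration» p.7 l.19). [cite: Gnayoro2026, §2.1 (1) p.2 l.15] -/
def StepR_cont : Prop :=
  ∀ (ν T : ℝ) (u : ℝ → E3 → E3) (p : ℝ → E3 → ℝ), IsSol ν T u p → ContinuousOn (R u) (Ico 0 T)

/-- **Step 11 — p.7 l.19** «Integration gives T_* ≤ 2/(c₀ R(0))»: the ODE comparison for a continuous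
`R` on `[0,T)` with `R(0) > 0` and `(c₀/2)R² ≤ dR/dt` on `(0,T)` (pure real analysis).
[cite: Gnayoro2026, Proof of Thm 1.1 p.7 l.19] -/
def Step11_integration : Prop :=
  ∀ (T : ℝ) (Rf : ℝ → ℝ), ContinuousOn Rf (Ico 0 T) → 0 < Rf 0 →
    (∀ t ∈ Ioo 0 T, c0 / 2 * Rf t ^ 2 ≤ deriv Rf t) → T ≤ 2 / (c0 * Rf 0)

/-- **Step 12 — p.7 l.18–19** «For data (2.3): R(0)=10⁵ … By Cor 6.3, dR/dt ≥ (c₀/2) R²»: the Riccati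
inequality along every `𝕋³`-classical solution issued from the datum, at `ν = 1`.
[cite: Gnayoro2026, Proof of Thm 1.1 p.7 l.18–19] -/
def Step12_proof : Prop :=
  ∀ (χ : E3 → ℝ) (ub : E3 → E3), IsCutoff₀ χ → IsBackground ub →
    ∀ (T : ℝ) (u : ℝ → E3 → E3) (p : ℝ → E3 → ℝ), IsSol 1 T u p → u 0 = datum χ ub →
      ∀ t ∈ Ioo 0 T, c0 / 2 * R u t ^ 2 ≤ deriv (R u) t

/-! ## Composition -/

/-- `sup = A` from «≤ A everywhere, = A at x₀». [cite: Gnayoro2026, Prop 2.2 (2) p.3 l.9] -/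
theorem supNorm_eq_of_le_of_eq {v : E3 → E3} {a : ℝ} (hle : ∀ x, ‖v x‖ ≤ a) {x₀ : E3}
    (hx₀ : ‖v x₀‖ = a) : supNorm v = a := by
  have hbdd : BddAbove (Set.range fun x => ‖v x‖) := ⟨a, by rintro _ ⟨x, rfl⟩; exact hle x⟩
  exact le_antisymm (ciSup_le hle) (hx₀ ▸ le_ciSup hbdd x₀)

/-- **The printed logic composes to the DELIVERED bound `2/(c₀A)`**: data smooth and divergence-free
(Step 1), `R(0) = A > 0` (Step 2), `R` continuous (Step R), the Riccati inequality along the solution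
(Step 12), integration (Step 11); the cutoff and the background are the members `exists_cutoff₀`,
`isBackground_zero`. [cite: Gnayoro2026, Proof of Thm 1.1 p.7 l.17–19] -/
theorem delivered_of_steps (h1 : Step1_data) (h2 : Step2_max) (hR : StepR_cont) (h12 : Step12_proof)
    (h11 : Step11_integration) : DeliveredTheorem := by
  obtain ⟨χ, hχ⟩ := exists_cutoff₀
  have hub : IsBackground 0 := isBackground_zero
  obtain ⟨hs, hd⟩ := h1 χ 0 hχ hub
  refine ⟨χ, 0, hχ, hub, hs, hd, fun T u p hsol h0 => ?_⟩
  obtain ⟨hle, hctr⟩ := h2 χ 0 hχ hub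
  have hR0 : R u 0 = amp := by
    simp only [R, h0]
    exact supNorm_eq_of_le_of_eq hle hctr
  have hpos : 0 < R u 0 := by rw [hR0]; unfold amp; positivity
  have := h11 T (R u) (hR 1 T u p hsol) hpos (h12 χ 0 hχ hub T u p hsol h0)
  simpa [Tproof, hR0] using this


/-! ## Rev 2 (typist-12 g5, append-only): Step 11 discharged -/

/-- **Riccati comparison** (the calculus behind p.7 l.19 «Integration gives T_* ≤ 2/(c₀R(0))»): a
continuous `R` on `[0,T)` with `R(0) > 0` and `c R² ≤ R'` on `(0,T)` (`c > 0`; `R'` = Mathlib `deriv`)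
forces `T ≤ 1/(c R(0))`. Proof: `R > R(0)/2` on `[0,T)` (at the first time `t₀` with `R(t₀) ≤ R(0)/2`,
monotonicity on `[0,t₀]` from `R' > 0` — `monotoneOn_of_deriv_nonneg` — contradicts it), hence `R`
is differentiable with `R' > 0` on `(0,T)`, and `(1/R)' = −R'/R² ≤ −c` integrates
(`Convex.image_sub_le_mul_sub_of_deriv_le`) to `0 < 1/R(t) ≤ 1/R(0) − ct`. [folklore]
[cite: Gnayoro2026, Proof of Thm 1.1 p.7 l.19] -/
theorem riccati_horizon_le {T c : ℝ} (hc : 0 < c) {Rf : ℝ → ℝ} (hcont : ContinuousOn Rf (Ico 0 T))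
    (h0 : 0 < Rf 0) (hineq : ∀ t ∈ Ioo 0 T, c * Rf t ^ 2 ≤ deriv Rf t) : T ≤ 1 / (c * Rf 0) := by
  by_contra hT
  push Not at hT
  have hTpos : 0 < T := lt_trans (by positivity) hT
  -- (1) positivity of `R` on `[0,T)`: `R 0 / 2 < R t`
  have hpos : ∀ t ∈ Ico (0:ℝ) T, Rf 0 / 2 < Rf t := by
    by_contra hneg
    push Not at hneg
    obtain ⟨t₁, ht₁, hle⟩ := hneg
    set B : Set ℝ := Icc 0 t₁ ∩ Rf ⁻¹' Iic (Rf 0 / 2) with hB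
    have hsub : Icc (0:ℝ) t₁ ⊆ Ico 0 T := fun s hs => ⟨hs.1, hs.2.trans_lt ht₁.2⟩
    have hBclosed : IsClosed B :=
      (hcont.mono hsub).preimage_isClosed_of_isClosed isClosed_Icc isClosed_Iic
    have hBne : B.Nonempty := ⟨t₁, ⟨ht₁.1, le_rfl⟩, hle⟩
    have hBbdd : BddBelow B := ⟨0, fun s hs => hs.1.1⟩
    set t₀ := sInf B with ht₀
    have ht₀B : t₀ ∈ B := hBclosed.csInf_mem hBne hBbdd
    have ht₀le : Rf t₀ ≤ Rf 0 / 2 := ht₀B.2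
    have ht₀nn : 0 ≤ t₀ := ht₀B.1.1
    have ht₀ne : t₀ ≠ 0 := by
      rintro h
      rw [h] at ht₀le
      linarith
    have ht₀pos : 0 < t₀ := lt_of_le_of_ne ht₀nn (Ne.symm ht₀ne)
    -- below `t₀`, `R > R 0 / 2`
    have hbelow : ∀ s ∈ Ico (0:ℝ) t₀, Rf 0 / 2 < Rf s := by
      intro s hs
      by_contra hs'
      push Not at hs'
      have hsB : s ∈ B := ⟨⟨hs.1, hs.2.le.trans ht₀B.1.2⟩, hs'⟩
      exact absurd (csInf_le hBbdd hsB) (not_le.mpr hs.2)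
    have hsubT : Icc (0:ℝ) t₀ ⊆ Ico 0 T := fun s hs => ⟨hs.1, (hs.2.trans ht₀B.1.2).trans_lt ht₁.2⟩
    have hcont₀ : ContinuousOn Rf (Icc 0 t₀) := hcont.mono hsubT
    have hderiv_pos : ∀ s ∈ Ioo (0:ℝ) t₀, 0 < deriv Rf s := by
      intro s hs
      have h1 := hbelow s ⟨hs.1.le, hs.2⟩
      have h2 := hineq s ⟨hs.1, (hs.2.trans_le ht₀B.1.2).trans ht₁.2⟩
      have : 0 < c * Rf s ^ 2 := by
        have : 0 < Rf s := by linarith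
        positivity
      linarith
    have hdiff₀ : DifferentiableOn ℝ Rf (interior (Icc 0 t₀)) := by
      rw [interior_Icc]
      intro s hs
      exact (differentiableAt_of_deriv_ne_zero (hderiv_pos s hs).ne').differentiableWithinAt
    have hmono : MonotoneOn Rf (Icc 0 t₀) :=
      monotoneOn_of_deriv_nonneg (convex_Icc 0 t₀) hcont₀ hdiff₀ (by
        rw [interior_Icc]; exact fun s hs => (hderiv_pos s hs).le)
    have := hmono ⟨le_rfl, ht₀nn⟩ ⟨ht₀nn, le_rfl⟩ ht₀nn
    linarith
  -- (2) differentiability and the inequality for `1/R`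
  have hRpos : ∀ t ∈ Ico (0:ℝ) T, 0 < Rf t := fun t ht => by linarith [hpos t ht]
  have hderiv_pos : ∀ t ∈ Ioo (0:ℝ) T, 0 < deriv Rf t := by
    intro t ht
    have h1 := hRpos t ⟨ht.1.le, ht.2⟩
    have h2 := hineq t ht
    have : 0 < c * Rf t ^ 2 := by positivity
    linarith
  have hdiffAt : ∀ t ∈ Ioo (0:ℝ) T, DifferentiableAt ℝ Rf t := fun t ht =>
    differentiableAt_of_deriv_ne_zero (hderiv_pos t ht).ne'
  set g : ℝ → ℝ := fun t => (Rf t)⁻¹ with hg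
  set t₁ : ℝ := 1 / (c * Rf 0) with ht₁
  have ht₁pos : 0 < t₁ := by positivity
  have ht₁T : t₁ < T := hT
  have hsub : Icc (0:ℝ) t₁ ⊆ Ico 0 T := fun s hs => ⟨hs.1, hs.2.trans_lt ht₁T⟩
  have hgcont : ContinuousOn g (Icc 0 t₁) :=
    (hcont.mono hsub).inv₀ fun s hs => (hRpos s (hsub hs)).ne'
  have hgderiv : ∀ s ∈ Ioo (0:ℝ) t₁, HasDerivAt g (-(deriv Rf s) / (Rf s) ^ 2) s := by
    intro s hs
    have hsT : s ∈ Ioo (0:ℝ) T := ⟨hs.1, hs.2.trans ht₁T⟩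
    exact ((hdiffAt s hsT).hasDerivAt).inv (hRpos s ⟨hs.1.le, hsT.2⟩).ne'
  have hgdiff : DifferentiableOn ℝ g (interior (Icc 0 t₁)) := by
    rw [interior_Icc]
    exact fun s hs => (hgderiv s hs).differentiableAt.differentiableWithinAt
  have hgle : ∀ s ∈ interior (Icc (0:ℝ) t₁), deriv g s ≤ -c := by
    rw [interior_Icc]
    intro s hs
    rw [(hgderiv s hs).deriv]
    have hsT : s ∈ Ioo (0:ℝ) T := ⟨hs.1, hs.2.trans ht₁T⟩
    have hR := hRpos s ⟨hs.1.le, hsT.2⟩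
    have h2 := hineq s hsT
    rw [div_le_iff₀ (by positivity)]
    linarith
  have hmvt := (convex_Icc (0:ℝ) t₁).image_sub_le_mul_sub_of_deriv_le hgcont hgdiff hgle
    0 ⟨le_rfl, ht₁pos.le⟩ t₁ ⟨ht₁pos.le, le_rfl⟩ ht₁pos.le
  -- `g t₁ ≤ g 0 - c t₁ = 0`, but `g t₁ > 0`
  have hg0 : g 0 = (Rf 0)⁻¹ := rfl
  have hgt₁ : 0 < g t₁ := inv_pos.mpr (hRpos t₁ ⟨ht₁pos.le, ht₁T⟩)
  have hct₁ : c * t₁ = (Rf 0)⁻¹ := by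
    rw [ht₁]; field_simp
  have : g t₁ ≤ 0 := by
    have := hmvt
    rw [hg0, sub_zero] at this
    linarith
  linarith

/-- **Step 11 holds** («Integration gives T_* ≤ 2/(c₀R(0))», p.7 l.19, as pure real analysis):
`riccati_horizon_le` with `c = c₀/2`. [cite: Gnayoro2026, Proof of Thm 1.1 p.7 l.19] -/
theorem step11_integration_holds : Step11_integration := by
  intro T Rf hcont h0 hineq
  have hc : 0 < c0 / 2 := by unfold c0; positivity
  have h := riccati_horizon_le hc hcont h0 hineq
  have : 1 / (c0 / 2 * Rf 0) = 2 / (c0 * Rf 0) := by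
    have hc0 : c0 ≠ 0 := by unfold c0; positivity
    field_simp
  rw [this] at h
  exact h

/-- The composition with Step 11 discharged. [cite: Gnayoro2026, Proof of Thm 1.1 p.7 l.17–19] -/
theorem delivered_of_steps₁ (h1 : Step1_data) (h2 : Step2_max) (hR : StepR_cont) (h12 : Step12_proof) :
    DeliveredTheorem :=
  delivered_of_steps h1 h2 hR h12 step11_integration_holds


/-! ## Rev 3 (typist-12 g5, append-only): Step R discharged — `R(t)` is continuous -/

/-- `0 < 2π`. [cite: Gnayoro2026, abstract p.1 l.10] -/
theorem per_pos : 0 < per := by unfold per; positivity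

/-- Integer translates along one axis leave a `2π`-periodic field invariant (induction on the
integer from the one-step periodicity `IsPer`). [folklore] [cite: Gnayoro2026, abstract p.1 l.10] -/
theorem IsPer.add_int_mul {X : Type*} {v : E3 → X} (hv : IsPer v) (j : Fin 3) (n : ℤ) (x : E3) :
    v (x + ((n : ℝ) * per) • EuclideanSpace.single j 1) = v x := by
  induction n using Int.induction_on generalizing x with
  | zero => simp
  | succ n ih =>
    have : x + ((((n : ℤ) + 1 : ℤ) : ℝ) * per) • (EuclideanSpace.single j (1 : ℝ) : E3) =
        (x + ((n : ℝ) * per) • (EuclideanSpace.single j (1 : ℝ) : E3)) +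
          per • (EuclideanSpace.single j (1 : ℝ) : E3) := by
      push_cast
      rw [add_mul, one_mul, add_smul, add_assoc]
    rw [this, hv j]
    have ih' := ih x
    push_cast at ih' ⊢
    exact ih'
  | pred n ih =>
    have key := hv j (x + (((-(n : ℤ) - 1 : ℤ) : ℝ) * per) • (EuclideanSpace.single j (1 : ℝ) : E3))
    have : x + (((-(n : ℤ) - 1 : ℤ) : ℝ) * per) • (EuclideanSpace.single j (1 : ℝ) : E3) +
        per • (EuclideanSpace.single j (1 : ℝ) : E3) =
          x + (((-(n : ℤ) : ℤ) : ℝ) * per) • (EuclideanSpace.single j (1 : ℝ) : E3) := by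
      push_cast
      rw [add_assoc, ← add_smul]
      ring_nf
    rw [this] at key
    have ih' := ih x
    push_cast at ih' key ⊢
    rw [← key, ih']

/-- Every point of `ℝ³` has a representative in the period cell `[0,2π]³` at which a periodic field
takes the same value (coordinatewise `toIcoMod`/`toIcoDiv`). [folklore] [cite: Gnayoro2026, §2.1 (1) p.2 l.15] -/
theorem IsPer.exists_mem_cell_eq {X : Type*} {v : E3 → X} (hv : IsPer v) (x : E3) :
    ∃ y ∈ cell, v y = v x := by
  set n : Fin 3 → ℤ := fun i => toIcoDiv per_pos 0 (x i) with hn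
  set y : E3 := WithLp.toLp 2 fun i => toIcoMod per_pos 0 (x i) with hy
  have hyi : ∀ i, y i = toIcoMod per_pos 0 (x i) := fun i => rfl
  refine ⟨y, fun i => ?_, ?_⟩
  · rw [hyi]
    have h := toIcoMod_mem_Ico per_pos 0 (x i)
    rw [zero_add] at h
    exact Ico_subset_Icc_self h
  · have hx : x = y + ((n 0 : ℝ) * per) • EuclideanSpace.single 0 1 +
        ((n 1 : ℝ) * per) • EuclideanSpace.single 1 1 + ((n 2 : ℝ) * per) • EuclideanSpace.single 2 1 := by
      ext i
      have h := toIcoMod_add_toIcoDiv_zsmul per_pos 0 (x i)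
      rw [zsmul_eq_mul] at h
      fin_cases i <;> simp [hyi, hn]
    rw [hx, hv.add_int_mul 2, hv.add_int_mul 1, hv.add_int_mul 0]

/-- For a periodic field, `sup_{ℝ³} |v| = sup_{[0,2π]³} |v|` («supₓ∈𝕋³»). [folklore] [cite: Gnayoro2026, §2.1 (1) p.2 l.15] -/
theorem IsPer.supNorm_eq_sSup_image {v : E3 → E3} (hv : IsPer v) :
    supNorm v = sSup ((fun x => ‖v x‖) '' cell) := by
  unfold supNorm
  rw [iSup]
  congr 1
  ext r
  constructor
  · rintro ⟨x, rfl⟩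
    obtain ⟨y, hy, he⟩ := hv.exists_mem_cell_eq x
    exact ⟨y, hy, by simp only [he]⟩
  · rintro ⟨y, _, rfl⟩
    exact ⟨y, rfl⟩

/-- The period cell `[0,2π]³` is compact. [folklore] [cite: Gnayoro2026, abstract p.1 l.10] -/
theorem isCompact_cell : IsCompact cell := by
  have h : cell = (EuclideanSpace.equiv (Fin 3) ℝ) ⁻¹' (Set.univ.pi fun _ => Icc (0 : ℝ) per) := by
    ext x
    simp only [cell, Set.mem_setOf_eq, Set.mem_preimage, Set.mem_univ_pi]
    rfl
  rw [h, ← ContinuousLinearEquiv.image_symm_eq_preimage]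
  exact (isCompact_univ_pi fun _ => isCompact_Icc).image (ContinuousLinearEquiv.continuous _)

/-- **Step R holds**: `t ↦ R(t) = ‖u(t)‖_∞` is continuous on `[0,T)` for a `𝕋³`-classical solution —
the sup over the compact cell of the jointly continuous `|u|` (`IsCompact.continuous_sSup`).
[folklore] [cite: Gnayoro2026, §2.1 (1) p.2 l.15] -/
theorem stepR_cont_holds : StepR_cont := by
  intro ν T u p hsol
  have hsm : ContinuousOn (Function.uncurry u) (Ico 0 T ×ˢ univ) := hsol.1.smooth_velocity.continuousOn
  set f : Ico (0 : ℝ) T → E3 → ℝ := fun t x => ‖u t x‖ with hf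
  have hfc : Continuous ↿f := by
    have h1 : Continuous fun q : Ico (0 : ℝ) T × E3 => ((q.1 : ℝ), q.2) :=
      (continuous_subtype_val.comp continuous_fst).prodMk continuous_snd
    have h2 : Continuous fun q : Ico (0 : ℝ) T × E3 => Function.uncurry u ((q.1 : ℝ), q.2) :=
      hsm.comp_continuous h1 fun q => ⟨q.1.2, mem_univ _⟩
    exact continuous_norm.comp h2
  have hcont : Continuous fun t : Ico (0 : ℝ) T => sSup (f t '' cell) := isCompact_cell.continuous_sSup hfc
  rw [continuousOn_iff_continuous_restrict]
  convert hcont using 1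
  funext t
  simp only [restrict_apply, R]
  exact (hsol.2 t t.2).1.supNorm_eq_sSup_image

/-- The composition with the classical/analytic ends discharged (Steps 11 and R): the printed
proof of Thm 1.1 composes to the delivered bound from the paper's own three displays — Prop 2.2 (1),
Prop 2.2 (2) and «dR/dt ≥ (c₀/2)R²» along the solution (p.7 l.18–19).
[cite: Gnayoro2026, Proof of Thm 1.1 p.7 l.17–19] -/
theorem delivered_of_steps₀ (h1 : Step1_data) (h2 : Step2_max) (h12 : Step12_proof) : DeliveredTheorem :=
  delivered_of_steps h1 h2 stepR_cont_holds h12 step11_integration_holds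


/-! ## Rev 4 (typist-12 g5, append-only + one import): Step 5 (Thm 2.3, local existence) discharged -/

/-- **Step 5 holds** (Thm 2.3, local existence, in the `2π`-periodic classical vocabulary): rescale the
datum to period `1` (`nsRescaleData 2π`), take the tree's periodic classical solution on some `[0,T')`
(`clayPeriodic_solvable_or_gradientSupBlowup`: either a global Clay solution, read with `u`, `p` periodic
through the Δ5 bridge, or the maximal one), and rescale back (`IsClassicalNSSolutionOn.nsRescale_holds`,
Leray's scaling keeps `ν`). [cite: Gnayoro2026, Thm 2.3 p.3 l.13–14] -/
theorem step5_local_holds : Step5_local := by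
  intro ν hν u₀ hs hd hper
  have hL : (0 : ℝ) < per := per_pos
  set v₀ : E3 → E3 := nsRescaleData per u₀ with hv₀
  have hs' : ContDiff ℝ ∞ v₀ := by
    have h : v₀ = fun x => per • u₀ (per • x) := funext fun x => rfl
    rw [h]
    exact (hs.comp (contDiff_const_smul per)).const_smul per
  have hd' : NSWave0.IsDivFree v₀ := by
    have h : v₀ = fun x => per • (fun y => u₀ (per • y)) x := funext fun x => rfl
    rw [h]
    exact VectorCalculus.IsDivFree.const_smul
      ((hs.differentiable (by simp)).comp (differentiable_id.const_smul per))
      (VectorCalculus.IsDivFree.comp_smul hd per) per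
  have hper' : IsLatticePeriodic v₀ := isLatticePeriodic_nsRescaleData hper
  -- a period-1 classical solution on some `[0, T')` with periodic velocity and pressure slices
  obtain ⟨T', hT', u', p', hcl', h0', hsl'⟩ : ∃ T' : ℝ, 0 < T' ∧ ∃ (u' : ℝ → E3 → E3) (p' : ℝ → E3 → ℝ),
      IsClassicalNSSolutionOn (Ico 0 T') ν 0 u' p' ∧ u' 0 = v₀ ∧
        ∀ t ∈ Ico 0 T', IsLatticePeriodic (u' t) ∧ IsLatticePeriodic (p' t) := by
    rcases clayPeriodic_solvable_or_gradientSupBlowup hν hs' hd' hper' with hsol | ⟨Ts, hTs, u', p', hcl', h0', hsl', -⟩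
    · have hE := (clayPeriodic_solvable_zero_iff_errata ν v₀).mp hsol
      obtain ⟨u', p', hu', hp', hns', hper''⟩ := hE
      obtain ⟨hcl, h0⟩ := isNavierStokesSolution_and_smooth_iff.1 ⟨hns', hu', hp'⟩
      have hper3 : ∀ t, 0 ≤ t → IsLatticePeriodic (u' t) ∧ IsLatticePeriodic (p' t) := hper''
      exact ⟨1, one_pos, u', p', hcl.mono Ico_subset_Ici_self (uniqueDiffOn_Ico 0 1), h0,
        fun t ht => hper3 t ht.1⟩
    · exact ⟨Ts, hTs, u', p', hcl', h0', hsl'⟩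
  -- rescale back to period `2π`
  have hc : 0 < per⁻¹ := inv_pos.mpr hL
  have key := IsClassicalNSSolutionOn.nsRescale_holds hcl' hc
  have hset : ((fun t : ℝ => per⁻¹ ^ 2 * t) ⁻¹' Ico (0 : ℝ) T') = Ico 0 (per ^ 2 * T') := by
    ext t
    simp only [mem_preimage, mem_Ico]
    have hp2 : 0 < per ^ 2 := by positivity
    have hpi : per⁻¹ ^ 2 = (per ^ 2)⁻¹ := by rw [inv_pow]
    rw [hpi]
    constructor
    · rintro ⟨h1, h2⟩
      refine ⟨?_, ?_⟩
      · have := mul_nonneg hp2.le h1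
        rwa [← mul_assoc, mul_inv_cancel₀ hp2.ne', one_mul] at this
      · have := mul_lt_mul_of_pos_left h2 hp2
        rwa [← mul_assoc, mul_inv_cancel₀ hp2.ne', one_mul] at this
    · rintro ⟨h1, h2⟩
      refine ⟨?_, ?_⟩
      · exact mul_nonneg (inv_nonneg.mpr hp2.le) h1
      · have := mul_lt_mul_of_pos_left h2 (inv_pos.mpr hp2)
        rwa [← mul_assoc, inv_mul_cancel₀ hp2.ne', one_mul] at this
  rw [hset, nsRescaleForce_zero] at key
  have hmem : ∀ t ∈ Ico (0 : ℝ) (per ^ 2 * T'), per⁻¹ ^ 2 * t ∈ Ico 0 T' := by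
    intro t ht
    have : t ∈ (fun t : ℝ => per⁻¹ ^ 2 * t) ⁻¹' Ico (0 : ℝ) T' := by rw [hset]; exact ht
    exact this
  refine ⟨per ^ 2 * T', by positivity, nsRescale per⁻¹ u', nsRescalePressure per⁻¹ p',
    ⟨key, fun t ht => ⟨fun j x => ?_, fun j x => ?_⟩⟩, ?_⟩
  · simp only [nsRescale_apply]
    exact periodic_smul_comp_inv_smul (hsl' _ (hmem t ht)).1 hL.ne' per⁻¹ j x
  · simp only [nsRescalePressure_apply, ← smul_eq_mul]
    exact periodic_smul_comp_inv_smul (hsl' _ (hmem t ht)).2 hL.ne' (per⁻¹ ^ 2) j x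
  · have hdat : nsRescaleData per⁻¹ (nsRescaleData per u₀) = u₀ := by
      rw [← nsRescaleData_mul, mul_inv_cancel₀ hL.ne', nsRescaleData_one]
    funext x
    have := congrFun hdat x
    simp only [nsRescaleData_apply] at this
    simp only [nsRescale_apply, mul_zero, h0']
    exact this

/-- `Step5_local` — `_holds` alias of `step5_local_holds` above under the fact's exact name (appended
2026-08-28, D-0026 bookkeeping: the proof term is the existing theorem of this file; no statement,
definition or attribute is edited; no new named fact; the ledger's debt table listed the fact
unproved). [cite: Gnayoro2026, Thm 2.3 p.3 l.13–14] -/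
theorem _root_.Literature.Claims.NS.Gnayoro2026.Step5_local_holds : Step5_local :=
  _root_.Literature.Claims.NS.Gnayoro2026.step5_local_holds

end Literature.Claims.NS.Gnayoro2026

end

-- WHAT THIS IS NOT: not a claim about NS regularity or blow-up; not a claim about any author beyond the typed locator.
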